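import Literature.AnabelianGeometry.EtaleTheta.ThetaCoversTemperedOfHuuOfSection
import Literature.AnabelianGeometry.EtaleTheta.SettingModelChiBarKerHuu
import Literature.AnabelianGeometry.EtaleTheta.SettingModelChiInversionTheta
import Literature.AnabelianGeometry.EtaleTheta.ThetaCoversTemperedOfSection
import HarnessLib

/-!
# abc-iut-L2-t2's `OrbitEmbedding C T` INHABITED at the KUMMER-carrying cusped inversion model `χ′` — the INSTANCE of
# abc-iut-L2-d3's `temperedCoverDataOfHuuOfSection` / `orbitEmbeddingOfHuuOfSection`, residual = {`C.Huu = Huuχ`, `τ`, `τ′`}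

S. Mochizuki, *The étale theta function and its Frobenioid-theoretic manifestations*, Publ. RIMS **45** (2009) [EtTh], §2:
Def. 2.1 p. 35 («the kernel of `Δ_X ↠ Δ̄_X`»), Prop. 2.2 (ii) p. 37, Def. 2.5 (i) p. 39, Def. 2.7 p. 41
[cite: MochizukiEtTh2009, Def 2.7 p.41]. Cell abc-iut, layer L2, seat abc-iut-L2-t10 (gen 6), row R442/R450 (2) «the INSTANCE
`nonempty_orbitEmbedding_inversionModelχ′` as a proof-only file consuming abc-iut-L2-d3's (B) constructors BY NAME».

v2 of this path (R450 ONE-ROW-ONE-HOLDER repair, least churn): v1 (p451746) carried this seat's own copy of the assembly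
(`temperedCoverDataOfHuuSection` / `orbitEmbeddingOfHuuSection` + four field identities, 0 consumers); abc-iut-L2-d3 g6's
`ThetaCoversTemperedOfHuuOfSection` (p452017 ✓) is the constructor OF RECORD, so those six declarations are WITHDRAWN here and the
two §2 theorems are kept with BYTE-IDENTICAL STATEMENTS, re-proved over abc-iut-L2-d3's constructors; PLUS the G-L2d3-7 clause
DISCHARGED at `χ′` (abc-iut-L2-t8 g7's kernel answer 14:40:09Z: `(modelχ′ p).barKerTp l = (modelχ p).barKerTp l` by `rfl`, so
abc-iut-L2-t8's `barKerTp_le_Huuχ` (p449957 ✓) transports literally) and the sharpened instance: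

* `iotaStable_conjX_epsPMInvχ'` — `C.IotaStable (conjX ε_±)` for every `X̲̲` with `Π^tp_{X̲̲} = Huuχ p l` (abc-iut-w5-d140's
  `conjX_epsPMInvχ'` + abc-iut-L2-d1's `map_Huuχ_twistedInversion`);
* `barKerTp_le_Huuχ_inversionModelχ'` — **`Ker(Δ^tp_X ↠ Δ̄_X) ≤ Huuχ p l` at `inversionModelχ′`** (G-L2d3-7 at the cusped model);
* `nonempty_orbitEmbedding_inversionModelχ'` (statement of v1, unchanged): `∃ T, T.Gtp = Π^tp_C ∧ Nonempty (C.OrbitEmbedding T)`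
  given {`hC`, `hK`, `τ`, `τ′`} — now with `T := temperedCoverDataOfHuuOfSection …` (abc-iut-L2-d3);
* **`nonempty_orbitEmbedding_inversionModelχ'_of_Huu_eq`** — the same GIVEN ONLY {`hC : C.Huu = Huuχ p l`, `τ`, `τ′`}: R312's
  `OrbitEmbedding` at a model WITH étale-theta data, every group-theoretic input a theorem; residual = the two Def. 1.9 points.

HONEST LIMITS: SYNTHETIC mod-`l` cusp datum (the Galois section's `D̄_x`-preimage); semi-synthetic model = consistency evidence for the
typed interface only; PROOF-ONLY (0 definitions, no instance, no `Prop` fact, no interface clause touched); nothing of [EtTh] asserted;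
no side taken on [IUTchIII] Cor. 3.12; typed ≠ proved; instantiated ≠ endorsed.
-/

noncomputable section

namespace Literature.AnabelianGeometry.EtaleTheta.SettingModel

open Literature.AnabelianGeometry.SemiGraphs ThetaCovers
open _root_.Topology

variable (p : ℕ) [Fact p.Prime]

/-- **`IotaStable` for the `ε_±`-conjugation of `inversionModelχ′`** on any `X̲̲` with `Π^tp_{X̲̲} = Huuχ p l`
(`conjX ε_± = twistedInversion χ`, abc-iut-w5-d140's `conjX_epsPMInvχ'`; `ι`-stability of `Huuχ`, abc-iut-L2-d1's
`map_Huuχ_twistedInversion`). [cite: MochizukiEtTh2009, Def 2.5 (i) p.39] -/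
theorem iotaStable_conjX_epsPMInvχ' {E : (ThetaSetting.modelχ' p).EtaleThetaData} {l : ℕ+}
    (C : E.DoubleUnderline (l : ℕ)) (hC : C.Huu = Huuχ p l) :
    C.IotaStable ((cLevelDataInvχ' p).conjX (epsPMInvχ p)) := by
  rw [conjX_epsPMInvχ']
  exact ⟨by rw [hC]; exact map_Huuχ_twistedInversion p l⟩

/-- **G-L2d3-7 at the cusped inversion model: `Ker(Δ^tp_X ↠ Δ̄_X) ≤ Huuχ p l` for odd `l`** — abc-iut-L2-t8's
`barKerTp_le_Huuχ` (at `modelχ`), transported along `(modelχ′ p).barKerTp l = (modelχ p).barKerTp l` (`rfl`: same `Δ^tp_X`,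
`toTheta`, `⟨l-th powers⟩`; the cusp datum of `curveχ′` is not read). [cite: MochizukiEtTh2009, Prop 2.2 (ii) p.37] -/
theorem barKerTp_le_Huuχ_inversionModelχ' (l : ℕ+) (hodd : Odd (l : ℕ)) :
    (MuTwoSetting.inversionModelχ' p).barKerTp l ≤ Huuχ p l :=
  barKerTp_le_Huuχ p l hodd

/-- **R312 at a model WITH étale-theta data — abc-iut-L2-t2's `OrbitEmbedding C T` is INHABITED at `inversionModelχ′` GIVEN ONLY
`hK : barKerTp l ≤ Huuχ p l` (G-L2d3-7) and the two Def. 1.9 points `τ`, `τ′`**: for ANY `E : (modelχ' p).EtaleThetaData` and ANY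
`C : E.DoubleUnderline l` with `C.Huu = Huuχ p l` (odd `l`), `T := temperedCoverDataOfHuuSection` over THE completion `toPiCHat`, with
the Galois section (`inr_mem_Huuχ`), `g := ε_±` (`iotaStable_conjX_epsPMInvχ'`), hιell (p443309) and L02 at `modelχ′` — every one a
theorem. [cite: MochizukiEtTh2009, Def 2.7 p.41] -/
theorem nonempty_orbitEmbedding_inversionModelχ' {E : (ThetaSetting.modelχ' p).EtaleThetaData} {l : ℕ+} (hodd : Odd (l : ℕ))
    (C : E.DoubleUnderline (l : ℕ)) (hC : C.Huu = Huuχ p l)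
    (hK : (MuTwoSetting.inversionModelχ' p).barKerTp l ≤ C.Huu)
    (τ τ' : ThetaSetting.NonCuspidalPoint E.toKummerData) :
    ∃ T : TemperedCoverData.{0} l, T.Gtp = (MuTwoSetting.inversionModelχ' p).GtpC ∧ Nonempty (C.OrbitEmbedding T) := by
  obtain ⟨eX⟩ := nonempty_oncePuncturedData_modelχ' p
  have hsH : ∀ σ, sectionχ' p σ ∈ C.Huu := fun σ => by rw [hC]; exact inr_mem_Huuχ p l σ
  refine ⟨(cLevelDataInvχ' p).temperedCoverDataOfHuuOfSection (cLevelDataInvχ' p).toPiCHat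
      (cLevelDataInvχ' p).isProfiniteCompletion_toPiCHat (cLevelDataInvχ' p).toPiCHat_injective eX hodd (sectionχ' p)
      (aug_sectionχ' p) (toZ_sectionχ' p) (inv_ell_piCData_inversionModelχ' p l eX)
      ((cLevelDataInvχ' p).map_inclX_GtpXu_normal l (kerToZIsCompactlyGenerated_modelχ' p))
      ((cLevelDataInvχ' p).map_inclX_GtpY_normal (kerToZIsCompactlyGenerated_modelχ' p)) C hK hsH
      (epsPMInvχ_not_mem_range p) (iotaStable_conjX_epsPMInvχ' p C hC), rfl, ?_⟩
  exact (cLevelDataInvχ' p).nonempty_orbitEmbeddingOfHuuOfSection _ _ _ eX hodd _ _ _ _ _ _ C hK hsH _ _ τ τ'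

/-- **R312 at the Kummer-carrying model, residual = the two Def. 1.9 points only**: for ANY étale-theta datum `E` over `modelχ′`
and ANY choice `X̲̲` with `Π^tp_{X̲̲} = Huuχ p l` (odd `l`), abc-iut-L2-t2's `OrbitEmbedding C T` is inhabited for a
`TemperedCoverData` on THE `Π^tp_C` of `inversionModelχ′`, given two non-cuspidal points `τ`, `τ′` — G-L2d3-7 discharged by
`barKerTp_le_Huuχ_inversionModelχ'`. [cite: MochizukiEtTh2009, Def 2.7 p.41] -/
theorem nonempty_orbitEmbedding_inversionModelχ'_of_Huu_eq {E : (ThetaSetting.modelχ' p).EtaleThetaData} {l : ℕ+}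
    (hodd : Odd (l : ℕ)) (C : E.DoubleUnderline (l : ℕ)) (hC : C.Huu = Huuχ p l)
    (τ τ' : ThetaSetting.NonCuspidalPoint E.toKummerData) :
    ∃ T : TemperedCoverData.{0} l, T.Gtp = (MuTwoSetting.inversionModelχ' p).GtpC ∧ Nonempty (C.OrbitEmbedding T) :=
  nonempty_orbitEmbedding_inversionModelχ' p hodd C hC (hC ▸ barKerTp_le_Huuχ_inversionModelχ' p l hodd) τ τ'

end Literature.AnabelianGeometry.EtaleTheta.SettingModel

end
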